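import Summits.Ventures.LatticeQCDFlow.Scaling.TaggedLoneBetweenBudget

/-!
HONEST FRAMING: exact (Metropolis-corrected) sampling algorithms for lattice gauge theory; figures
of merit are autocorrelation/cost numbers at stated couplings and volumes; no continuum-physics
claim.

# TaggedLoneBetweenBudgetSharp — THE LONE HUB STRICTLY BETWEEN THE EXTRA PARTICLES: THE DISCOUNTED BUDGET WITH THE `α^{n+2}` TERMS KEPT (IT VANISHES AT EVEN ATTEMPTS AS
# `α → 1`), AND THE `K = 2` SCALAR INEQUALITY (lean-2 GEN-43, ours)

Venture-side (OURS).  Cell `lqcd-flow` (pub-lqcd), unit `pub-lqcd-lean-2-g43`, 2026-08-31.  Chapter AC (route (β), the cost side concluded), file 1 — the tools that close the one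
configuration of Conjecture W′ left open at `K = 2` by chapter AB (file 16 there: `W_b ≤ W_z < W_a`, `N_C(z) = 1`, every other present content strictly below `W_z`).

Chapter AB file 15b (`loneBetween_budget`) summed the SIGNED decomposition through the tag position at `W_z` — the residual `g`-form `ζ_n − x_n ≤ cⁿ(g_n(1) − g_n(α))` and the
hub-above bound `y_{n+1} − ζ_{n+1} ≤ 𝟙{n even}c^{n+1}/2`, `y_1 ≤ ζ_1` — after the majorisations `(α − α^{n+2})/(1+α) ≤ α/(1+α)` (even attempts) and `α^{n+2} ≤ α²` (odd attempts); the
first of these is what loses the corner `α, σ → 1` at `K = 2` (memo MEMO-gen42 §5: ratio 0.80), where the even-attempt majorant `(α − α^{n+2})/(1+α)` in fact VANISHES.  Keeping both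
powers, the per-step majorant is `𝟙{n odd}c^{n+1}(α − α^{n+2})/(1+α) + 𝟙{n even, n ≠ 0}c^{n+1}α^{n+2}/(1+α)` (at odd attempts `½ − (1 − α^{n+2})/(1+α) ≤ α^{n+2}/(1+α)`), and its
discounted sum is still a closed form — in which neither the position of the second particle nor that of `b` enters:

* §1 `budget_oddGeom_diff_le`: `Σ_{n<J, n odd}(tⁿ − α²(tα)ⁿ) ≤ t/(1−t²) − α²·tα/(1−(tα)²)` (`0 ≤ α ≤ 1`, `0 ≤ t < 1`; the two tails compare termwise);
  **`loneBetween_budget_sharp`**: `Σ_{n<J}(1−σ)σⁿ(y_{n+1} − x_{n+1})⁺ ≤ (1−σ)·(α/(1+α))·σc²·[1/(1−(σc)²) − α²/(1+σcα)]` (same hypotheses as `loneBetween_budget`).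
* §2 **`costSide_scalar_loneBetween_two`**: at `K = 2` (`c = ½`, `0 ≤ L ≤ 10`) this budget is at most chapter AB file 15b's residual income
  `2·[α(K−2+3θ_a)/K + σ(α/K)(1−α)(1−θ_a)/(1+α)]/((1−σ/K)(1+σα/K))`: with `x = σ/2` the cleared form is
  `(1+x)[3θ_a(1+α) + 2x(1−α)(1−θ_a)] − 5x[1 + xα − α²(1−x²)] ≥ (3/2 − 5x/2 + x²) + α(3/2 + x/2 − 6x²) + α²(5x − 5x³) ≥ ¼` on `x ≤ ½`, `θ_a ≥ ½` (toy `numerics43/k2_budget.py`: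
  ratio ≥ 1.20, attained as `α → 0`, `σ → 1`; NOTHING CLAIMED beyond the typed statement).

File 2 of this chapter turns these into the cost side `L·D_J ≤ 2s1` and Conjecture W′ for the lone hub strictly between at `K = 2`, hence on every adjacent edge from every ordinary hub
for every `K ≥ 2`.  Literature grade (cell rule): OWN; nothing cited; no new bib keys.
-/

open Finset

namespace Summit.Ventures.LatticeQCDFlow.Scaling

/-! ### §1 The discounted budget with the powers kept -/
section LoneBudgetSharp

/-- `Σ_{n<J, n odd}(tⁿ − α²(tα)ⁿ) ≤ t/(1−t²) − α²·(tα)/(1−(tα)²)` for `0 ≤ α ≤ 1`, `0 ≤ t < 1`: the difference of two odd geometric sums, whose tails compare termwise. [ours] -/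
theorem budget_oddGeom_diff_le {t α : ℝ} (ht0 : 0 ≤ t) (ht1 : t < 1) (hα0 : 0 ≤ α) (hα1 : α ≤ 1) (J : ℕ) :
    ∑ n ∈ range J, (if Odd n then α * t ^ n - α ^ 2 * (t * α) ^ n else 0)
      ≤ α * (t / (1 - t ^ 2)) - α ^ 2 * (t * α / (1 - (t * α) ^ 2)) := by
  have htα0 : 0 ≤ t * α := mul_nonneg ht0 hα0
  have htα1 : t * α ≤ t := mul_le_of_le_one_right ht0 hα1
  have h1 : 0 < 1 - t ^ 2 := by nlinarith
  have h2 : 0 < 1 - (t * α) ^ 2 := by nlinarith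
  have h12 : 1 - t ^ 2 ≤ 1 - (t * α) ^ 2 := by nlinarith [pow_le_pow_left₀ htα0 htα1 2]
  set N := J + (if Even J then 1 else 0) with hN
  have hsplit : ∑ n ∈ range J, (if Odd n then α * t ^ n - α ^ 2 * (t * α) ^ n else 0)
      = α * ∑ n ∈ range J, (if Odd n then t ^ n else 0) - α ^ 2 * ∑ n ∈ range J, (if Odd n then (t * α) ^ n else 0) := by
    rw [mul_sum, mul_sum, ← sum_sub_distrib]
    refine sum_congr rfl fun n _ => ?_
    split_ifs <;> ring
  have hA : ∑ n ∈ range J, (if Odd n then t ^ n else 0) = (t - t ^ N) / (1 - t ^ 2) := by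
    rw [eq_div_iff h1.ne', mul_comm]; exact budget_oddGeom_eq t J
  have hB : ∑ n ∈ range J, (if Odd n then (t * α) ^ n else 0) = (t * α - (t * α) ^ N) / (1 - (t * α) ^ 2) := by
    rw [eq_div_iff h2.ne', mul_comm]; exact budget_oddGeom_eq (t * α) J
  rw [hsplit, hA, hB]
  -- the tails: `α²(tα)^N/(1−(tα)²) ≤ α·t^N/(1−t²)`
  have htail : α ^ 2 * ((t * α) ^ N / (1 - (t * α) ^ 2)) ≤ α * (t ^ N / (1 - t ^ 2)) := by
    have hp : (t * α) ^ N ≤ t ^ N := pow_le_pow_left₀ htα0 htα1 N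
    have hp0 : 0 ≤ (t * α) ^ N := pow_nonneg htα0 N
    have hα2 : α ^ 2 ≤ α := by nlinarith
    calc α ^ 2 * ((t * α) ^ N / (1 - (t * α) ^ 2)) ≤ α * ((t * α) ^ N / (1 - (t * α) ^ 2)) :=
          mul_le_mul_of_nonneg_right hα2 (div_nonneg hp0 h2.le)
      _ ≤ α * (t ^ N / (1 - (t * α) ^ 2)) := mul_le_mul_of_nonneg_left (div_le_div_of_nonneg_right hp h2.le) hα0
      _ ≤ α * (t ^ N / (1 - t ^ 2)) := mul_le_mul_of_nonneg_left (div_le_div_of_nonneg_left (pow_nonneg ht0 N) h1 h12) hα0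
  have e1 : (t - t ^ N) / (1 - t ^ 2) = t / (1 - t ^ 2) - t ^ N / (1 - t ^ 2) := by rw [sub_div]
  have e2 : (t * α - (t * α) ^ N) / (1 - (t * α) ^ 2) = t * α / (1 - (t * α) ^ 2) - (t * α) ^ N / (1 - (t * α) ^ 2) := by rw [sub_div]
  rw [e1, e2, mul_sub, mul_sub]
  linarith

/-- **The budget of the lone hub strictly between with the powers kept** (see the module docstring): under the hypotheses of chapter AB file 15b's `loneBetween_budget`,
`Σ_{n<J}(1−σ)σⁿ(y_{n+1} − x_{n+1})⁺ ≤ (1−σ)·(α/(1+α))·σc²·[1/(1−(σc)²) − α²/(1+σcα)]`. [ours] -/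
theorem loneBetween_budget_sharp {xz yz ζz : ℕ → ℝ} {α c σ : ℝ} (hα0 : 0 ≤ α) (hα1 : α ≤ 1) (hc0 : 0 ≤ c) (hσ0 : 0 ≤ σ) (hσ1 : σ ≤ 1) (hσc : σ * c < 1)
    (hg : ∀ n, ζz n - xz n ≤ c ^ n * ((-(1:ℝ) - (-(1:ℝ)) ^ (n + 1)) / (1 + 1) - (-α - (-α) ^ (n + 1)) / (1 + α)))
    (hB : ∀ n, yz (n + 1) - ζz (n + 1) ≤ if Even n then c ^ (n + 1) / 2 else 0) (hO : yz 1 ≤ ζz 1) (J : ℕ) :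
    ∑ n ∈ range J, (1 - σ) * σ ^ n * max 0 (yz (n + 1) - xz (n + 1))
      ≤ (1 - σ) * ((α / (1 + α)) * (σ * c ^ 2) * (1 / (1 - (σ * c) ^ 2) - α ^ 2 / (1 + σ * c * α))) := by
  have h1α : 0 < 1 + α := by linarith
  -- the per-step bound with the powers kept
  have hterm : ∀ n, max 0 (yz (n + 1) - xz (n + 1))
      ≤ (if Odd n then c ^ (n + 1) * ((α - α ^ (n + 2)) / (1 + α)) else 0) + (if Even n ∧ n ≠ 0 then c ^ (n + 1) * (α ^ (n + 2) / (1 + α)) else 0) := by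
    intro n
    have h1 := hg (n + 1)
    have h2 := hB n
    have hcn : 0 ≤ c ^ (n + 1) := pow_nonneg hc0 _
    rcases Nat.even_or_odd n with hev | hod
    · -- `n` even: attempt `n+1` odd
      rw [if_neg (Nat.not_odd_iff_even.mpr hev), zero_add]
      have hev2 : Even (n + 2) := hev.add even_two
      rw [show n + 1 + 1 = n + 2 from rfl] at h1
      have hg1 : (-(1:ℝ) - (-(1:ℝ)) ^ (n + 2)) / (1 + 1) = -1 := by rw [Even.neg_pow hev2, one_pow]; norm_num
      have hpow : (-α) ^ (n + 2) = α ^ (n + 2) := Even.neg_pow hev2 α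
      rw [hg1, hpow] at h1
      rw [if_pos hev] at h2
      -- `ζ_{n+1} − x_{n+1} ≤ c^{n+1}(−1 + (α + α^{n+2})/(1+α)) = −c^{n+1}(1 − α^{n+2})/(1+α)`
      have h4 : ζz (n + 1) - xz (n + 1) ≤ c ^ (n + 1) * (-1 + (α + α ^ (n + 2)) / (1 + α)) := by
        have e : (-1:ℝ) - (-α - α ^ (n + 2)) / (1 + α) = -1 + (α + α ^ (n + 2)) / (1 + α) := by ring
        rw [e] at h1; exact h1
      by_cases hn0 : n = 0
      · subst hn0
        rw [if_neg (by simp)]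
        refine max_le le_rfl ?_
        have h3 : yz 1 - ζz 1 ≤ 0 := by linarith [hO]
        have h5 : -1 + (α + α ^ (0 + 2)) / (1 + α) ≤ 0 := by
          rw [show (0:ℕ) + 2 = 2 by rfl]
          have : (α + α ^ 2) / (1 + α) = α := by rw [div_eq_iff h1α.ne']; ring
          rw [this]; linarith
        have h6 : ζz (0 + 1) - xz (0 + 1) ≤ 0 := h4.trans (mul_nonpos_of_nonneg_of_nonpos hcn h5)
        simp only [Nat.zero_add] at h6 ⊢
        linarith
      · rw [if_pos (show Even n ∧ n ≠ 0 from ⟨hev, hn0⟩)]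
        refine max_le (mul_nonneg hcn (div_nonneg (pow_nonneg hα0 _) h1α.le)) ?_
        -- `½ − (1 − α^{n+2})/(1+α) ≤ α^{n+2}/(1+α)`
        have h5 : c ^ (n + 1) / 2 + c ^ (n + 1) * (-1 + (α + α ^ (n + 2)) / (1 + α)) ≤ c ^ (n + 1) * (α ^ (n + 2) / (1 + α)) := by
          have hkey : 1 / 2 + (-1 + (α + α ^ (n + 2)) / (1 + α)) ≤ α ^ (n + 2) / (1 + α) := by
            rw [← sub_nonneg]
            have e : α ^ (n + 2) / (1 + α) - (1 / 2 + (-1 + (α + α ^ (n + 2)) / (1 + α)))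
                = (1 - α) / (2 * (1 + α)) := by field_simp; ring
            rw [e]; exact div_nonneg (by linarith) (by linarith)
          have := mul_le_mul_of_nonneg_left hkey hcn
          linarith
        linarith [h2, h4, h5]
    · -- `n` odd: attempt `n+1` even; the hub-above half has no deficit, the residual half at most `c^{n+1}(α − α^{n+2})/(1+α)`
      rw [if_pos hod, if_neg (fun h => (Nat.not_even_iff_odd.mpr hod) h.1), add_zero]
      rw [if_neg (Nat.not_even_iff_odd.mpr hod)] at h2
      have hodd2 : Odd (n + 2) := hod.add_even even_two
      rw [show n + 1 + 1 = n + 2 from rfl] at h1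
      have hg1 : (-(1:ℝ) - (-(1:ℝ)) ^ (n + 2)) / (1 + 1) = 0 := by rw [Odd.neg_pow hodd2, one_pow]; norm_num
      have hpow : (-α) ^ (n + 2) = -α ^ (n + 2) := Odd.neg_pow hodd2 α
      rw [hg1, hpow] at h1
      have hαpow : α ^ (n + 2) ≤ α := by
        calc α ^ (n + 2) ≤ α ^ 1 := pow_le_pow_of_le_one hα0 hα1 (by omega)
          _ = α := pow_one α
      refine max_le (mul_nonneg hcn (div_nonneg (by linarith) h1α.le)) ?_
      have h4 : ζz (n + 1) - xz (n + 1) ≤ c ^ (n + 1) * ((α - α ^ (n + 2)) / (1 + α)) := by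
        have e : (0:ℝ) - (-α - -α ^ (n + 2)) / (1 + α) = (α - α ^ (n + 2)) / (1 + α) := by ring
        rw [e] at h1; exact h1
      linarith [h2, h4]
  -- the discounted sum
  have hσc0 : 0 ≤ σ * c := mul_nonneg hσ0 hc0
  have hσcα0 : 0 ≤ σ * c * α := mul_nonneg hσc0 hα0
  have hσcα : σ * c * α < 1 := by nlinarith
  have hodd : ∑ n ∈ range J, σ ^ n * (if Odd n then c ^ (n + 1) * ((α - α ^ (n + 2)) / (1 + α)) else 0)
      ≤ (c / (1 + α)) * (α * (σ * c / (1 - (σ * c) ^ 2)) - α ^ 2 * (σ * c * α / (1 - (σ * c * α) ^ 2))) := by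
    have hpt : ∀ n, σ ^ n * (c ^ (n + 1) * ((α - α ^ (n + 2)) / (1 + α))) = (c / (1 + α)) * (α * (σ * c) ^ n - α ^ 2 * (σ * c * α) ^ n) := by
      intro n
      rw [div_mul_eq_mul_div, eq_div_iff h1α.ne', mul_pow, mul_pow, mul_pow, pow_succ, pow_add]
      field_simp
    have e : ∑ n ∈ range J, σ ^ n * (if Odd n then c ^ (n + 1) * ((α - α ^ (n + 2)) / (1 + α)) else 0)
        = (c / (1 + α)) * ∑ n ∈ range J, (if Odd n then α * (σ * c) ^ n - α ^ 2 * (σ * c * α) ^ n else 0) := by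
      rw [mul_sum]
      refine sum_congr rfl fun n _ => ?_
      split_ifs
      · exact hpt n
      · rw [mul_zero, mul_zero]
    rw [e]
    exact mul_le_mul_of_nonneg_left (budget_oddGeom_diff_le hσc0 hσc hα0 hα1 J) (by positivity)
  have heven : ∑ n ∈ range J, σ ^ n * (if Even n ∧ n ≠ 0 then c ^ (n + 1) * (α ^ (n + 2) / (1 + α)) else 0)
      ≤ (c * α ^ 2 / (1 + α)) * ((σ * c * α) ^ 2 / (1 - (σ * c * α) ^ 2)) := by
    have hpt : ∀ n, σ ^ n * (c ^ (n + 1) * (α ^ (n + 2) / (1 + α))) = (c * α ^ 2 / (1 + α)) * (σ * c * α) ^ n := by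
      intro n
      rw [div_mul_eq_mul_div, eq_div_iff h1α.ne', mul_pow, mul_pow, pow_succ, pow_add]
      field_simp
    have e : ∑ n ∈ range J, σ ^ n * (if Even n ∧ n ≠ 0 then c ^ (n + 1) * (α ^ (n + 2) / (1 + α)) else 0)
        = (c * α ^ 2 / (1 + α)) * ∑ n ∈ range J, (if Even n ∧ n ≠ 0 then (σ * c * α) ^ n else 0) := by
      rw [mul_sum]
      refine sum_congr rfl fun n _ => ?_
      split_ifs
      · exact hpt n
      · rw [mul_zero, mul_zero]
    rw [e]
    exact mul_le_mul_of_nonneg_left (budget_evenPos_le hσcα0 hσcα J) (by positivity)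
  -- the closed form
  have hclosed : (c / (1 + α)) * (α * (σ * c / (1 - (σ * c) ^ 2)) - α ^ 2 * (σ * c * α / (1 - (σ * c * α) ^ 2)))
      + (c * α ^ 2 / (1 + α)) * ((σ * c * α) ^ 2 / (1 - (σ * c * α) ^ 2))
      = (α / (1 + α)) * (σ * c ^ 2) * (1 / (1 - (σ * c) ^ 2) - α ^ 2 / (1 + σ * c * α)) := by
    have hd1 : 1 - (σ * c) ^ 2 ≠ 0 := by nlinarith
    have hd2 : 1 - σ * c * α ≠ 0 := by linarith
    have hd3 : 1 + σ * c * α ≠ 0 := by linarith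
    have hd4 : 1 + α ≠ 0 := h1α.ne'
    have hd2' : 1 - (σ * c * α) ^ 2 = (1 - σ * c * α) * (1 + σ * c * α) := by ring
    have hd1' : 1 - c ^ 2 * σ ^ 2 ≠ 0 := by rw [show 1 - c ^ 2 * σ ^ 2 = 1 - (σ * c) ^ 2 by ring]; exact hd1
    have hd2'' : 1 - c * α * σ ≠ 0 := by rw [show 1 - c * α * σ = 1 - σ * c * α by ring]; exact hd2
    have hd3' : 1 + c * α * σ ≠ 0 := by rw [show 1 + c * α * σ = 1 + σ * c * α by ring]; exact hd3
    rw [hd2']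
    field_simp
    ring
  calc ∑ n ∈ range J, (1 - σ) * σ ^ n * max 0 (yz (n + 1) - xz (n + 1))
      ≤ ∑ n ∈ range J, (1 - σ) * (σ ^ n * ((if Odd n then c ^ (n + 1) * ((α - α ^ (n + 2)) / (1 + α)) else 0)
          + (if Even n ∧ n ≠ 0 then c ^ (n + 1) * (α ^ (n + 2) / (1 + α)) else 0))) := by
        refine sum_le_sum fun n _ => ?_
        rw [mul_assoc]
        exact mul_le_mul_of_nonneg_left (mul_le_mul_of_nonneg_left (hterm n) (pow_nonneg hσ0 n)) (by linarith)
    _ = (1 - σ) * (∑ n ∈ range J, σ ^ n * (if Odd n then c ^ (n + 1) * ((α - α ^ (n + 2)) / (1 + α)) else 0)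
          + ∑ n ∈ range J, σ ^ n * (if Even n ∧ n ≠ 0 then c ^ (n + 1) * (α ^ (n + 2) / (1 + α)) else 0)) := by
        rw [← sum_add_distrib, mul_sum]; exact sum_congr rfl fun n _ => by ring
    _ ≤ (1 - σ) * ((c / (1 + α)) * (α * (σ * c / (1 - (σ * c) ^ 2)) - α ^ 2 * (σ * c * α / (1 - (σ * c * α) ^ 2)))
          + (c * α ^ 2 / (1 + α)) * ((σ * c * α) ^ 2 / (1 - (σ * c * α) ^ 2))) := mul_le_mul_of_nonneg_left (add_le_add hodd heven) (by linarith)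
    _ = _ := by rw [hclosed]

end LoneBudgetSharp

/-! ### §2 The scalar inequality at `K = 2` -/
section ScalarTwo

/-- **The scalar inequality of the lone hub strictly between at `K = 2`:** the sharp budget `(α/(1+α))·(σ/4)·[1/(1−σ²/4) − α²/(1+σα/2)]` times `L ≤ 10` is at most twice the
residual income `[3αθ_a/2 + (σα/2)(1−α)(1−θ_a)/(1+α)]/((1−σ/2)(1+σα/2))`; cleared form `(1+x)[3θ_a(1+α) + 2x(1−α)(1−θ_a)] − 5x[1 + xα − α²(1−x²)] ≥ ¼`, `x = σ/2`. [ours] -/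
theorem costSide_scalar_loneBetween_two {L α θa σ : ℝ} (hL : L ≤ 10) (hα0 : 0 ≤ α) (hα1 : α ≤ 1)
    (hθ : 1 / 2 ≤ θa) (hσ0 : 0 ≤ σ) (hσ1 : σ ≤ 1) :
    L * ((α / (1 + α)) * (σ * (1 / (2:ℝ)) ^ 2) * (1 / (1 - (σ * (1 / (2:ℝ))) ^ 2) - α ^ 2 / (1 + σ * (1 / (2:ℝ)) * α)))
      ≤ 2 * ((α * ((2:ℝ) - 2 + 3 * θa) / 2 + σ * (α / 2) * ((1 - α) * (1 - θa) / (1 + α))) / ((1 - σ / 2) * (1 + σ * α / 2))) := by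
  -- `x = σ/2 ∈ [0, ½]`
  have h1α : 0 < 1 + α := by linarith
  obtain ⟨x, hx⟩ : ∃ x : ℝ, x = σ / 2 := ⟨_, rfl⟩
  have hx0 : 0 ≤ x := by rw [hx]; positivity
  have hx1 : x ≤ 1 / 2 := by rw [hx]; linarith
  have hxα0 : 0 ≤ x * α := mul_nonneg hx0 hα0
  have hxα1 : x * α ≤ 1 / 2 := by nlinarith
  have hD1 : 0 < 1 - x ^ 2 := by nlinarith
  have hD2 : 0 < 1 + x * α := by linarith
  have hD4 : 0 < 1 - x := by linarith
  have hD5 : 0 < 1 + x := by linarith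
  -- rewrite everything in `x`
  have e1 : σ * (1 / (2:ℝ)) ^ 2 = x / 2 := by rw [hx]; ring
  have e2 : (σ * (1 / (2:ℝ))) ^ 2 = x ^ 2 := by rw [hx]; ring
  have e3 : σ * (1 / (2:ℝ)) * α = x * α := by rw [hx]; ring
  have e4 : σ / 2 = x := hx.symm
  have e5 : σ * α / 2 = x * α := by rw [hx]; ring
  have e6 : σ * (α / 2) = x * α := by rw [hx]; ring
  rw [e1, e2, e3, e4, e5, e6]
  -- the budget core is non-negative, so `L ≤ 10` may be used
  have hbr : 0 ≤ 1 / (1 - x ^ 2) - α ^ 2 / (1 + x * α) := by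
    have h1 : 1 ≤ 1 / (1 - x ^ 2) := by rw [le_div_iff₀ hD1]; nlinarith [sq_nonneg x]
    have hα2 : α ^ 2 ≤ 1 := by nlinarith
    have h2 : α ^ 2 / (1 + x * α) ≤ 1 := by rw [div_le_one hD2]; linarith
    linarith
  have hcore0 : 0 ≤ (α / (1 + α)) * (x / 2) * (1 / (1 - x ^ 2) - α ^ 2 / (1 + x * α)) :=
    mul_nonneg (mul_nonneg (div_nonneg hα0 h1α.le) (by linarith)) hbr
  have hstep : L * ((α / (1 + α)) * (x / 2) * (1 / (1 - x ^ 2) - α ^ 2 / (1 + x * α)))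
      ≤ 10 * ((α / (1 + α)) * (x / 2) * (1 / (1 - x ^ 2) - α ^ 2 / (1 + x * α))) := mul_le_mul_of_nonneg_right hL hcore0
  refine hstep.trans ?_
  -- the cleared polynomial inequality
  have hF : 0 ≤ (1 + x) * (3 * θa * (1 + α) + 2 * x * (1 - α) * (1 - θa)) - 5 * x * (1 + x * α - α ^ 2 * (1 - x ^ 2)) := by
    -- `5/4 − 5x/2 + x² = (½ − x)(2 − x) + ¼`, `3/2 + x/2 − 6x² = 6(½ − x)(½ + x) + x/2`, `5x − 5x³ = 5x(1 − x²)`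
    have hq1 : 0 ≤ 3 / 2 - 5 / 2 * x + x ^ 2 - 1 / 4 := by
      have h := mul_nonneg (show (0:ℝ) ≤ 1 / 2 - x by linarith) (show (0:ℝ) ≤ 2 - x by linarith)
      nlinarith [h]
    have hq2 : 0 ≤ 3 / 2 + x / 2 - 6 * x ^ 2 := by
      have h := mul_nonneg (show (0:ℝ) ≤ 1 / 2 - x by linarith) (show (0:ℝ) ≤ 1 / 2 + x by linarith)
      nlinarith [h]
    have hq3 : 0 ≤ 5 * x - 5 * x ^ 3 := by
      have h := mul_nonneg hx0 hD1.le
      nlinarith [h]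
    have hθp : 0 ≤ (θa - 1 / 2) * ((1 + x) * (3 * (1 + α) - 2 * x * (1 - α))) := by
      refine mul_nonneg (by linarith) (mul_nonneg hD5.le ?_)
      have h := mul_nonneg hx0 hα0
      linarith
    have e : (1 + x) * (3 * θa * (1 + α) + 2 * x * (1 - α) * (1 - θa)) - 5 * x * (1 + x * α - α ^ 2 * (1 - x ^ 2))
        = ((3 / 2 - 5 / 2 * x + x ^ 2 - 1 / 4) + 1 / 4 + α * (3 / 2 + x / 2 - 6 * x ^ 2) + α ^ 2 * (5 * x - 5 * x ^ 3))
          + (θa - 1 / 2) * ((1 + x) * (3 * (1 + α) - 2 * x * (1 - α))) := by ring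
    rw [e]
    have h2 := mul_nonneg hα0 hq2
    have h3 := mul_nonneg (pow_nonneg hα0 2) hq3
    linarith
  -- both sides as single fractions
  have eL : 10 * ((α / (1 + α)) * (x / 2) * (1 / (1 - x ^ 2) - α ^ 2 / (1 + x * α)))
      = 5 * x * α * (1 + x * α - α ^ 2 * (1 - x ^ 2)) / ((1 + α) * (1 - x ^ 2) * (1 + x * α)) := by
    field_simp
    ring
  have eR : 2 * ((α * ((2:ℝ) - 2 + 3 * θa) / 2 + x * α * ((1 - α) * (1 - θa) / (1 + α))) / ((1 - x) * (1 + x * α)))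
      = α * (3 * θa * (1 + α) + 2 * x * (1 - α) * (1 - θa)) / ((1 + α) * (1 - x) * (1 + x * α)) := by
    field_simp
    ring
  rw [eL, eR, div_le_div_iff₀ (mul_pos (mul_pos h1α hD1) hD2) (mul_pos (mul_pos h1α hD4) hD2)]
  -- `(1 − x²) = (1 − x)(1 + x)`: the difference of the cross products is `α(1+α)²(1−x)(1+xα)² · F`
  have key : α * (3 * θa * (1 + α) + 2 * x * (1 - α) * (1 - θa)) * ((1 + α) * (1 - x ^ 2) * (1 + x * α))
      - 5 * x * α * (1 + x * α - α ^ 2 * (1 - x ^ 2)) * ((1 + α) * (1 - x) * (1 + x * α))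
      = α * ((1 + α) * (1 - x) * (1 + x * α))
        * ((1 + x) * (3 * θa * (1 + α) + 2 * x * (1 - α) * (1 - θa)) - 5 * x * (1 + x * α - α ^ 2 * (1 - x ^ 2))) := by
    ring
  have hcommon : 0 ≤ α * ((1 + α) * (1 - x) * (1 + x * α)) := mul_nonneg hα0 (mul_nonneg (mul_nonneg h1α.le hD4.le) hD2.le)
  have key' : 0 ≤ α * (3 * θa * (1 + α) + 2 * x * (1 - α) * (1 - θa)) * ((1 + α) * (1 - x ^ 2) * (1 + x * α))
      - 5 * x * α * (1 + x * α - α ^ 2 * (1 - x ^ 2)) * ((1 + α) * (1 - x) * (1 + x * α)) := by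
    rw [key]; exact mul_nonneg hcommon hF
  linarith

end ScalarTwo

end Summit.Ventures.LatticeQCDFlow.Scaling
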